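import Summits.Ventures.PackingBounds.Energy.NFGramPSD
import HarnessLib

/-!
# Row-range chunks of the number-field Gram deviation check (KERNEL-NF, step 2 — large blocks)

Framing: lottery ticket; floor = certified bounds/negative ranges. Venture `PackingBounds`, cell `pub-packcert`,
energy family E3PT (pub-packcert-energy gen 22; companion of `NFGramPSD`).

A 63 × 63 SOS block over a cubic field carries ≈ 2 M digits of integer data, more than one gate file may hold; the
emitter splits the data over several modules and checks the per-entry deviation conditions per ROW RANGE
(`checkDev2Rows`, one `decide` per chunk). `psd_of_nf_facts2` is `NFGram.psd_of_nf_checks2` with the deviation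
hypothesis in unpacked (facts) form, so that the chunk facts can be combined by a case split on the row index.
-/

/-! ### Row-range chunks of the per-entry deviation check (for blocks whose data must be split over several modules) -/

namespace Summit.Ventures.PackingBounds.Energy.NFGram

open Finset
open Summit.Ventures.PackingBounds.Config.AlgWeighted
open Summit.Ventures.PackingBounds.Energy.GramData

/-- `checkDev2` restricted to the rows `i0 ≤ i < i1` (all columns `j < r`). -/
def checkDev2Rows (r ℓ i0 i1 : ℕ) (a b : ℤ) (Dx : ℕ) (F : List (List (List ℤ))) (Dn : List (List ℕ))
    (C : List (List ℤ)) (Y : List (List ℤ)) (S m : ℕ) : Bool :=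
  ((List.range i1).filter (fun i => i0 ≤ i)).all fun i =>
    ((List.range r).all fun j =>
        ((devPoly2 F Dn Y S i j).length == ℓ) && decide (0 < entN Dn i j) &&
          decide (devBound2 a b Dx F Dn Y S i j ≤ ent C i j * (entN Dn i j : ℤ))) &&
      decide (crow C i r ≤ 2 * (m : ℤ) * (Dx : ℤ) ^ ℓ)

/-- Unpack a checked row range. -/
theorem of_checkDev2Rows {r ℓ i0 i1 : ℕ} {a b : ℤ} {Dx : ℕ} {F : List (List (List ℤ))} {Dn : List (List ℕ)}
    {C Y : List (List ℤ)} {S m : ℕ} (h : checkDev2Rows r ℓ i0 i1 a b Dx F Dn C Y S m = true) :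
    ∀ i, i0 ≤ i → i < i1 →
      (∀ j, j < r → (devPoly2 F Dn Y S i j).length = ℓ ∧ 0 < entN Dn i j ∧
          devBound2 a b Dx F Dn Y S i j ≤ ent C i j * (entN Dn i j : ℤ)) ∧
        crow C i r ≤ 2 * (m : ℤ) * (Dx : ℤ) ^ ℓ := by
  intro i hi0 hi1
  simp only [checkDev2Rows, List.all_eq_true, List.mem_filter, List.mem_range, Bool.and_eq_true, beq_iff_eq,
    decide_eq_true_eq] at h
  have hh := h i ⟨hi1, hi0⟩
  exact ⟨fun j hj => ⟨(hh.1 j hj).1.1, (hh.1 j hj).1.2, (hh.1 j hj).2⟩, hh.2⟩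

/-- **PSD from per-entry deviation FACTS** (the unpacked form of `psd_of_nf_checks2`, so that row chunks checked in
separate modules can be combined by the caller). -/
theorem psd_of_nf_facts2 (r s m ℓ : ℕ) (F : List (List (List ℤ))) (Dn : List (List ℕ)) (C : List (List ℤ))
    (Y L E : List (List ℤ)) (S Dx : ℕ) (a b : ℤ) (ξ : ℝ) (hS : 0 < S) (hDx : 0 < Dx)
    (ha : (a : ℝ) ≤ Dx * ξ) (hb : (Dx : ℝ) * ξ ≤ b)
    (hrows : ∀ i j, i < r → j < r → ent Y i j = dotRows L i j s + ent E i j ∧ ent E i j = ent E j i)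
    (hdd : ∀ i, i < r → absRow E i r + 2 * (m : ℤ) ≤ 2 * ent E i i)
    (hdev : ∀ i, i < r →
      (∀ j, j < r → (devPoly2 F Dn Y S i j).length = ℓ ∧ 0 < entN Dn i j ∧
          devBound2 a b Dx F Dn Y S i j ≤ ent C i j * (entN Dn i j : ℤ)) ∧
        crow C i r ≤ 2 * (m : ℤ) * (Dx : ℤ) ^ ℓ)
    (y : Fin r → ℝ) :
    0 ≤ ∑ i : Fin r, ∑ j : Fin r, (leval ξ (entF F i j) / (entN Dn i j : ℝ)) * y i * y j := by
  have hSr : (0 : ℝ) < S := by exact_mod_cast hS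
  have hDxr : (0 : ℝ) < Dx := by exact_mod_cast hDx
  have hpow : (0 : ℝ) < (Dx : ℝ) ^ ℓ := by positivity
  set Q : Fin r → Fin r → ℝ := fun i j => (ent Y i j : ℝ) / S with hQdef
  set P : Fin r → Fin r → ℝ := fun i j => leval ξ (entF F i j) / (entN Dn i j : ℝ) - (ent Y i j : ℝ) / S
    with hPdef
  have hQ : ∀ z : Fin r → ℝ, (m : ℝ) / S * ∑ i, z i ^ 2 ≤ ∑ i, ∑ j, Q i j * z i * z j := by
    intro z
    have h := pd_of_checks_margin r s m Y L E hrows hdd z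
    have hre : ∑ i, ∑ j, Q i j * z i * z j = (∑ i : Fin r, ∑ j : Fin r, (ent Y i j : ℝ) * z i * z j) / S := by
      rw [Finset.sum_div]
      refine Finset.sum_congr rfl fun i _ => ?_
      rw [Finset.sum_div]
      refine Finset.sum_congr rfl fun j _ => ?_
      simp only [hQdef]; ring
    rw [hre, div_mul_eq_mul_div, le_div_iff₀ hSr, div_mul_cancel₀ _ hSr.ne']
    exact h
  have hPent : ∀ i j : Fin r, |P i j| ≤ (ent C i j : ℝ) / ((Dx : ℝ) ^ ℓ * S) := by
    intro i j
    obtain ⟨hl, hdpos, hC⟩ := (hdev i i.2).1 j j.2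
    have hdr : (0 : ℝ) < (entN Dn i j : ℝ) := by exact_mod_cast hdpos
    have hb' := abs_devPoly2_le ha hb F Dn Y S i j hl
    have hval := leval_devPoly2 ξ F Dn Y S i j
    have hCr : (devBound2 a b Dx F Dn Y S i j : ℝ) ≤ (ent C i j : ℝ) * (entN Dn i j : ℝ) := by
      exact_mod_cast hC
    have hP' : P i j = leval ξ (devPoly2 F Dn Y S i j) / ((S : ℝ) * (entN Dn i j : ℝ)) := by
      simp only [hPdef]; rw [hval]; field_simp
    rw [hP', abs_div, abs_of_pos (mul_pos hSr hdr), div_le_div_iff₀ (mul_pos hSr hdr) (by positivity)]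
    have h1 : |leval ξ (devPoly2 F Dn Y S i j)| * ((Dx : ℝ) ^ ℓ * S)
        = ((Dx : ℝ) ^ ℓ * |leval ξ (devPoly2 F Dn Y S i j)|) * S := by ring
    rw [h1]
    have h2 : (ent C i j : ℝ) * ((S : ℝ) * (entN Dn i j : ℝ)) = ((ent C i j : ℝ) * (entN Dn i j : ℝ)) * S := by ring
    rw [h2]
    exact mul_le_mul_of_nonneg_right (le_trans hb' hCr) hSr.le
  have hP : ∀ i : Fin r, ∑ j, (|P i j| + |P j i|) ≤ 2 * ((m : ℝ) / S) := by
    intro i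
    have h1 : ∑ j : Fin r, (|P i j| + |P j i|)
        ≤ ∑ j : Fin r, (((ent C i j : ℝ) + (ent C j i : ℝ)) / ((Dx : ℝ) ^ ℓ * S)) := by
      refine Finset.sum_le_sum fun j _ => ?_
      rw [add_div]
      exact add_le_add (hPent i j) (hPent j i)
    have h2 : ∑ j : Fin r, (((ent C i j : ℝ) + (ent C j i : ℝ)) / ((Dx : ℝ) ^ ℓ * S))
        = (crow C i r : ℝ) / ((Dx : ℝ) ^ ℓ * S) := by
      rw [crow_eq, ← Finset.sum_div,
        ← Fin.sum_univ_eq_sum_range (fun j => ((ent C i j : ℝ) + (ent C j i : ℝ))) r]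
    have h3 : (crow C i r : ℝ) ≤ 2 * (m : ℝ) * (Dx : ℝ) ^ ℓ := by exact_mod_cast (hdev i i.2).2
    rw [h2] at h1
    refine le_trans h1 ?_
    rw [div_le_iff₀ (by positivity)]
    have : 2 * ((m : ℝ) / S) * ((Dx : ℝ) ^ ℓ * S) = 2 * (m : ℝ) * (Dx : ℝ) ^ ℓ := by field_simp
    rw [this]
    exact h3
  have key := quadForm_nonneg_of_margin Q P ((m : ℝ) / S) hQ hP y
  have hre : ∑ i : Fin r, ∑ j : Fin r, (leval ξ (entF F i j) / (entN Dn i j : ℝ)) * y i * y j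
      = ∑ i, ∑ j, (Q i j + P i j) * y i * y j := by
    refine Finset.sum_congr rfl fun i _ => Finset.sum_congr rfl fun j _ => ?_
    simp only [hQdef, hPdef]; ring
  rw [hre]
  exact key

end Summit.Ventures.PackingBounds.Energy.NFGram
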